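import Mathlib

/-!
# Tier 4 — Literature: HOWE DUALITY as printed (archimedean: Howe 1989; non-archimedean: Gan–Takeda 2016), seat t4-lit-3

Blind re-derivation cell `pub-hodge-repro`, Tier-4 literature seat `t4-lit-3` (gen 1; README §9–§10).  Target tree path
`lean/Summits/Ventures/HodgeRepro/Tier4/LitHoweDuality.lean`; HOME copy `lit/t4/LitHoweDuality.lean`; the deposit rows
`proofs/t4/inputs/t4-lit-3.md` I-t4-lit-3-41 (Howe 1989, the JOURNAL PRINT, HOME `lit/t4-lit-3-fetch/Howe1989-jams2-ams-print/`)
and I-t4-lit-3-43 (Gan–Takeda, the HELD arXiv AUTHOR COPY `paper:arxiv-1407.1995` of the JAMS 29 (2016) print = WANTED W47,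
print not held) carry the verbatim statements with their page / chunk lines.

WHY THIS FILE.  Line L4's census names «[I4] Howe duality» as one of the four free inputs of its bridge
(`Tier4/Line4/Skeleton.lean` §5: «the isolation's dual + Howe duality + [I1] force the two theta-partners to be `τ″` and
`τ″^∨`»).  This file makes that input DISPLAYABLE BY NAME at every place: `Howe1989_Thm1` for the real places (the print)
and `GanTakeda2016_Thm1_2` for the finite places (the author copy; «closed on author copy» per README §8(iv) until the print
lands).  Each is ONE `def … : Prop` over an interface of PARAMETERS (the representations, the occurrence relation, the
theta quotient, the Hom-dimension — every field an object the printed theorem quantifies over, nothing constructed), with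
the printed hypotheses EXPLICIT as premises and NO proof of any published theorem.  The two `theorem`s at the end are pure
logic on the `∃!` clauses (no published content).  The bridge from a line's objects (its local representations at a place)
to these interfaces is the line's (or a typer's) to write and to justify.

THE PRINTS.
[H89] R. Howe, «Transcending classical invariant theory», J. Amer. Math. Soc. 2 (1989), no. 3, 535–552 (W46 CLOSED, seat-side
Wayback capture of the publisher-open AMS PDF; row 41).  p. 535 (setting, read on the PDF page): «Let `Sp_{2n}(ℝ) = Sp_{2n} = Sp`
be the real symplectic group of rank `n`.  Let `S̃p` denote the two-fold cover of `Sp`.  There is a unitary representation,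
constructed by Shale [Sh] and Weil [W1], of `S̃p` … We denote this representation by `ω` and call it the oscillator
representation. … Let `E` be a reductive subgroup of `Sp`, and let `Ẽ` denote the inverse image of `E` in `S̃p`.  Denote by
`ℛ(Ẽ)` the set of infinitesimal equivalence classes of continuous irreducible admissible representations of `Ẽ` on locally
convex spaces.  Let `ω^∞` be the smooth representation of `S̃p` associated to `ω`. … Denote by `ℛ(Ẽ, ω)` the set of elements
of `ℛ(Ẽ)` which are realized as quotients by `ω^∞` … [`(G, G′)` a reductive dual pair in `Sp`, `G̃`, `G̃′` their inverse
images, which commute].  **Theorem 1.** The set `ℛ(G̃·G̃′, ω)` is the graph of a bijection between (all of) `ℛ(G̃, ω)` and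
(all of) `ℛ(G̃′, ω)`.  Moreover, an element `ρ ⊗ ρ′` of `ℛ(G̃·G̃′, ω)` occurs as a quotient of `ω^∞` in a unique way.»
(p. 536: Theorem 1A, the finitely generated admissible quasisimple `G̃′`-module with its unique irreducible quotient, and
Remark (b) «If `G` or `G′` is compact, then Theorems 1 and 1A are already known»; p. 538 Lemma 2.2 «Theorems 1 and 1A follow
from Theorem 2.1».)
[GT16] W. T. Gan, S. Takeda, «A proof of the Howe duality conjecture», J. Amer. Math. Soc. 29 (2016) 473–493 — read on the
arXiv author copy `paper:arxiv-1407.1995` (chunks p0003:L3–L83, p0004:L20–L50; row 43): «Let `F` be a nonarchimedean local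
field of characteristic not 2 and residue characteristic `p`.  Let `E` be `F` itself or a quadratic field extension of `F`.
For `ε = ±`, we consider a `−ε`-Hermitian space `W` over `E` of dimension `n` and an `ε`-Hermitian space `V` of dimension
`m`.  Let `G(W)` and `H(V)` denote the isometry group of `W` and `V` respectively.  Then the group `G(W) × H(V)` forms a
dual reductive pair and possesses a Weil representation `ω_ψ` … for any irreducible admissible representation `π` of
`G(W)`, one may consider the maximal `π`-isotypic quotient of `ω_ψ`.  This has the form `π ⊗ Θ_{W,V,ψ}(π)` for some smooth
representation `Θ_{W,V,ψ}(π)` of `H(V)` … It was shown by Kudla [k83] that `Θ(π)` has finite length (possibly zero), so we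
may consider its maximal semisimple quotient `θ(π)`.  One has the following fundamental conjecture due to Howe [H1, howe]:
**Howe Duality Conjecture for `G(W) × H(V)`.** (i) `θ(π)` is either `0` or irreducible.  (ii) If `θ(π) = θ(π′) ≠ 0`, then
`π = π′`.  A concise reformulation is: for any irreducible `π` and `π′`, (HD) `dim Hom_{H(V)}(θ(π), θ(π′)) ≤ δ_{π,π′} :=
1` if `π ≅ π′`; `0` if `π ≇ π′`. … **Theorem 1.2.** The Howe duality conjecture (HD) holds for the pair `G(W) × H(V)`.»
Scope printed at p0004:L20–L31: the proof «does not apply to these quaternionic dual pairs» (Theorem 1.3 gives only the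
Hermitian form there) — the cell's pairs (`U(W) × U(V)` for `E/F` quadratic, any `p`) are in scope.

WHAT IS BUILT INTO THE TYPINGS (README §9).  `ArchDualPair` carries the archimedean setting of [H89] as parameters
(`isReductiveDualPair` = «`(G, G′)` is a reductive dual pair in `Sp_{2n}(ℝ)`»); `Howe1989_Thm1` reads «graph of a bijection
between (all of) `ℛ(G̃, ω)` and (all of) `ℛ(G̃′, ω)`» as the three clauses graph ⊆ product, ∃! partner on the left, ∃! partner
on the right, plus «in a unique way» as `quotMult = 1`.  `PadicDualPair` carries the [GT16] setting (`nonArchCharNeTwo` =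
«`F` nonarchimedean of characteristic not 2», `notQuaternionic` = «symplectic-orthogonal or unitary pair»); the `δ_{π,π′}`
display is rendered as the two implications `π ≅ π′ → dim ≤ 1` and `π ≇ π′ → dim = 0` (no decidability of `≅` assumed).
Nothing here says anything about the status of the Hodge conjecture for CM abelian varieties, which is NOT proved;
HC_CM is NOT proved by anyone in this repository.
-/

set_option autoImplicit false

noncomputable section

namespace Summit.Ventures.HodgeRepro.Tier4.Lit

/-! ## [H89] Theorem 1 — the archimedean Howe duality, as parameters -/

/-- **The archimedean setting of [H89] p. 535 as parameters**: `RepG` / `RepG'` = `ℛ(G̃)` / `ℛ(G̃′)`, the infinitesimal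
equivalence classes of continuous irreducible admissible representations of the inverse images `G̃`, `G̃′` of the members of a
reductive dual pair `(G, G′)` in `Sp_{2n}(ℝ)` inside the metaplectic double cover; `inR` / `inR'` = membership in
`ℛ(G̃, ω)` / `ℛ(G̃′, ω)` («realized as quotients by `ω^∞`», `ω` the oscillator representation); `inRR ρ ρ'` = «`ρ ⊗ ρ′ ∈
ℛ(G̃·G̃′, ω)`»; `quotMult ρ ρ'` = the number of ways `ρ ⊗ ρ′` occurs as a quotient of `ω^∞` (`dim Hom_{G̃·G̃′}(ω^∞, ρ ⊗ ρ′)`);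
`isReductiveDualPair` = the standing hypothesis of Theorem 1.  Every field is a parameter of the printed setting. -/
structure ArchDualPair where
  /-- `ℛ(G̃)` -/
  RepG : Type
  /-- `ℛ(G̃′)` -/
  RepG' : Type
  /-- `ρ ∈ ℛ(G̃, ω)` -/
  inR : RepG → Prop
  /-- `ρ′ ∈ ℛ(G̃′, ω)` -/
  inR' : RepG' → Prop
  /-- `ρ ⊗ ρ′ ∈ ℛ(G̃·G̃′, ω)` -/
  inRR : RepG → RepG' → Prop
  /-- the number of ways `ρ ⊗ ρ′` occurs as a quotient of `ω^∞` -/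
  quotMult : RepG → RepG' → ℕ
  /-- «`(G, G′)` a reductive dual pair in `Sp_{2n}(ℝ)`» -/
  isReductiveDualPair : Prop

/-- **[H89] Theorem 1, p. 535, AS PRINTED** (row I-t4-lit-3-41): «The set `ℛ(G̃·G̃′, ω)` is the graph of a bijection between
(all of) `ℛ(G̃, ω)` and (all of) `ℛ(G̃′, ω)`.  Moreover, an element `ρ ⊗ ρ′` of `ℛ(G̃·G̃′, ω)` occurs as a quotient of
`ω^∞` in a unique way.»  Premise: the reductive dual pair hypothesis.  Clauses: the graph lies in `ℛ(G̃, ω) × ℛ(G̃′, ω)`;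
every `ρ ∈ ℛ(G̃, ω)` has exactly one partner `ρ′` with `ρ ⊗ ρ′ ∈ ℛ(G̃·G̃′, ω)`; every `ρ′ ∈ ℛ(G̃′, ω)` has exactly one
partner `ρ`; the occurrence is unique (`quotMult = 1`). -/
def Howe1989_Thm1 (D : ArchDualPair) : Prop :=
  D.isReductiveDualPair →
    (∀ ρ ρ', D.inRR ρ ρ' → D.inR ρ ∧ D.inR' ρ') ∧
    (∀ ρ, D.inR ρ → ∃! ρ', D.inRR ρ ρ') ∧
    (∀ ρ', D.inR' ρ' → ∃! ρ, D.inRR ρ ρ') ∧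
    (∀ ρ ρ', D.inRR ρ ρ' → D.quotMult ρ ρ' = 1)

/-! ## [GT16] Theorem 1.2 — the non-archimedean Howe duality (all residual characteristics), as parameters -/

/-- **The non-archimedean setting of [GT16] §1 as parameters** (p0003:L3–L30): `RepG` = the irreducible admissible
representations `π` of `G(W)`; `RepH` = the smooth representations of `H(V)` (a type large enough to hold every `θ(π)`);
`theta π` = `θ(π)`, the maximal semisimple quotient of `Θ(π)` (the `H(V)`-partner of the maximal `π`-isotypic quotient of the
Weil representation `ω_ψ`; finite length by Kudla); `homDim σ σ'` = `dim Hom_{H(V)}(σ, σ′)`; `iso π π'` = «`π ≅ π′`»;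
`nonArchCharNeTwo` = «`F` a nonarchimedean local field of characteristic not 2» (any residue characteristic `p`);
`notQuaternionic` = «`G(W) × H(V)` a symplectic-orthogonal or unitary dual pair» (`E = F` or a quadratic extension, `W`
`−ε`-Hermitian, `V` `ε`-Hermitian over `E`; the quaternionic pairs are excluded by the print, p0004:L20–L31). -/
structure PadicDualPair where
  /-- the irreducible admissible representations of `G(W)` -/
  RepG : Type
  /-- the smooth representations of `H(V)` -/
  RepH : Type
  /-- `θ(π)`: the maximal semisimple quotient of `Θ(π)` -/
  theta : RepG → RepH
  /-- `dim Hom_{H(V)}(σ, σ′)` -/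
  homDim : RepH → RepH → ℕ
  /-- `π ≅ π′` -/
  iso : RepG → RepG → Prop
  /-- «`F` a nonarchimedean local field of characteristic not 2» -/
  nonArchCharNeTwo : Prop
  /-- «symplectic-orthogonal or unitary dual pair» (not quaternionic) -/
  notQuaternionic : Prop

/-- **[GT16] Theorem 1.2 in the printed display (HD), AS PRINTED** (row I-t4-lit-3-43): «for any irreducible `π` and `π′`,
(HD) `dim Hom_{H(V)}(θ(π), θ(π′)) ≤ δ_{π,π′} := 1` if `π ≅ π′`; `0` if `π ≇ π′`» — «Theorem 1.2. The Howe duality conjecture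
(HD) holds for the pair `G(W) × H(V)`.»  Premises: the printed scope (`F` non-archimedean of characteristic `≠ 2`; the pair
symplectic-orthogonal or unitary).  The `δ` display is the two implications below. -/
def GanTakeda2016_Thm1_2 (D : PadicDualPair) : Prop :=
  D.nonArchCharNeTwo → D.notQuaternionic →
    ∀ π π' : D.RepG,
      (D.iso π π' → D.homDim (D.theta π) (D.theta π') ≤ 1) ∧
      (¬ D.iso π π' → D.homDim (D.theta π) (D.theta π') = 0)

/-! ## Glue (pure logic on the clauses; no published content) -/

/-- From [H89] Theorem 1: the theta partner of `ρ ∈ ℛ(G̃, ω)` is unique — two `ρ′, ρ″` with `ρ ⊗ ρ′`, `ρ ⊗ ρ″ ∈ ℛ(G̃·G̃′, ω)`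
coincide.  Pure logic on the `∃!` clause. -/
theorem Howe1989_Thm1.partner_unique (D : ArchDualPair) (h : Howe1989_Thm1 D) (hpair : D.isReductiveDualPair)
    {ρ : D.RepG} {ρ' ρ'' : D.RepG'} (h1 : D.inRR ρ ρ') (h2 : D.inRR ρ ρ'') : ρ' = ρ'' := by
  obtain ⟨hsub, hleft, -, -⟩ := h hpair
  obtain ⟨hρ, -⟩ := hsub ρ ρ' h1
  obtain ⟨_, -, huniq⟩ := hleft ρ hρ
  exact (huniq ρ' h1).trans (huniq ρ'' h2).symm

/-- From [H89] Theorem 1: the theta partner on the `G̃′`-side is unique as well — two `ρ, σ` with `ρ ⊗ ρ′`, `σ ⊗ ρ′ ∈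
ℛ(G̃·G̃′, ω)` coincide.  Pure logic on the `∃!` clause. -/
theorem Howe1989_Thm1.partner_unique' (D : ArchDualPair) (h : Howe1989_Thm1 D) (hpair : D.isReductiveDualPair)
    {ρ σ : D.RepG} {ρ' : D.RepG'} (h1 : D.inRR ρ ρ') (h2 : D.inRR σ ρ') : ρ = σ := by
  obtain ⟨hsub, -, hright, -⟩ := h hpair
  obtain ⟨-, hρ'⟩ := hsub ρ ρ' h1
  obtain ⟨_, -, huniq⟩ := hright ρ' hρ'
  exact (huniq ρ h1).trans (huniq σ h2).symm

/-- From [GT16] Theorem 1.2: if `θ(π)` and `θ(π′)` admit a non-zero `H(V)`-map, then `π ≅ π′` (the contrapositive of the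
`π ≇ π′` clause of (HD)).  Pure logic. -/
theorem GanTakeda2016_Thm1_2.iso_of_homDim_ne_zero (D : PadicDualPair) (h : GanTakeda2016_Thm1_2 D)
    (hF : D.nonArchCharNeTwo) (hQ : D.notQuaternionic) {π π' : D.RepG}
    (hne : D.homDim (D.theta π) (D.theta π') ≠ 0) : D.iso π π' := by
  by_contra hiso
  exact hne ((h hF hQ π π').2 hiso)

end Summit.Ventures.HodgeRepro.Tier4.Lit
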